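import Mathlib.LinearAlgebra.Matrix.Determinant.Basic
import Mathlib.LinearAlgebra.Matrix.Notation
import Mathlib.Tactic.Ring
import Mathlib.Tactic.LinearCombination
import Mathlib.Tactic.FieldSimp
import Mathlib.Tactic.NormNum
import HarnessLib

/-!
# Venture HSemireg — the RATIO LEMMA's covolume step (ENGINE-W PROBE5 §10, THEOREM R1-ε): the block determinant
# `det [[p·I, q·G],[r·F, s·I]] = (ps − qr)²` for `GF = I`, the value `ps − qr = (b² − m)∕4`, and `ε₂ = sgn(b² − m)·ε₁` — kernel algebra

HONEST FRAMING. Lean index of the computation cell `pub-hsemireg`, widening group ENGINE-W (code A, seat `engine-w-1`, gen 17). RING ∕ FIELD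
ALGEBRA (a `4 × 4` determinant identity and three one-line identities); no abelian variety, sheaf, `Ext` group, secant structure, hermitian
lattice or semiregularity map is constructed; nothing here says that HC, HC_CM or HC_AV holds. Theorems only (0 `def`, 0 named fact, 0 `sorry`).
New namespace `RatioLemma`.

SOURCE (the cell's own result): `widen/ENGINE-W/out/probe5/PROBE5-STIZ-A.md` §10 (v1.6, engine-w-1 g5∕g6) as printed: «LEMMA (weight 2 vs weight 1,
same nodes). … `𝒥^{(2)} = D⁻¹𝒥^{(1)}D` with `D = diag(2,2,1,1)` … whence **`h₂ = 2h₁`** and **`I₂ = {x ∈ F : x·₁e ∈ M′}`, `M′ := ℤ² ⊕ ½ℤ²`**.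
If `m ∓ 2 = b²` (`b` odd), put `a₀ := (b + l)∕2`, `N_{F∕F^τ}(a₀) = (b² − m)∕4 … ∈ {+½, −½}`: the matrix of `a₀` in structure 1, `(b + 𝒥^{(1)})∕2 =
[[(b−A)∕2·I, −(N∕2)F⁻¹],[(t∕2)F, (b+A)∕2·I]]`, maps `ℤ⁴` INTO `M′` … with covolume `|N_{F∕ℚ}(a₀)| = ((b²−m)∕4)² = ¼ = covol(M′)` — so ONTO:
`a₀·₁ℤ⁴ = M′` and **`I₂ = a₀·I₁` exactly**. Hence … **`ε₂ = h_s∕(h₂·N(a₀x₁)) = ε₁ ∕ (2·N_{F∕F^τ}(a₀)) = ε₁ · 2∕(b² − m) = sgn(b² − m)·ε₁.`** ∎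
Instances: `m = 3` (`b = 1`, `1 − 3 = −2`): `ε₂ = −ε₁`; `m = 11` (`b = 3`, `−2`): `−ε₁`; `m = 7` (`b = 3`, `+2`), `m = 23` (`b = 5`, `+2`), `m = −1`
(`b = 1`, `+2`): `ε₂ = +ε₁`», with `tN = A² − m` (the target relation). What the kernel holds (`G = F⁻¹` enters through `G·F = I`):

* §1 **`det_block`** — for ANY `2 × 2` blocks `G, F` and scalars `p, q, r, s` over a commutative ring:
  `det [[p·I, q·G],[r·F, s·I]] = (ps)² − ps·qr·tr(GF) + (qr)²·det G·det F` (cofactor expansion, `ring`); **`det_block_of_inverse`** — if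
  `G·F = I` then `det [[p·I, q·G],[r·F, s·I]] = (ps − qr)²` («covolume `|N_{F∕ℚ}(a₀)|`», the square of a `2 × 2` determinant).
* §2 **`ps_sub_qr`** — with `p = (b−A)∕2`, `q = −N∕2`, `r = t∕2`, `s = (b+A)∕2` and `tN = A² − m`: `ps − qr = (b² − m)∕4` (`= N_{F∕F^τ}(a₀)`);
  `covolume_cases` — `b² − m = ±2 ⟹ (ps − qr)² = 1∕4` (`= covol(ℤ² ⊕ ½ℤ²)` by value).
* §3 **`epsilon_ratio`** — `ε₂ = ε₁∕(2·N(a₀))` with `N(a₀) = (b² − m)∕4 = ±½` gives `ε₂ = ±ε₁`, i.e. `ε₂ = (2∕(b² − m))·ε₁ = sgn(b² − m)·ε₁`;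
  `instances` — `(m, b, b² − m) = (3, 1, −2), (11, 3, −2), (7, 3, 2), (23, 5, 2), (−1, 1, 2)`.
WHAT IS NOT HERE: the structures `𝒥^{(1)}, 𝒥^{(2)}`, the lattices `I₁, I₂, M′`, THEOREM ε; THEOREM R1-ε as a statement about transports.
-/

namespace Summit.Ventures.HSemireg.RatioLemma

open Matrix

/-! ## §1 The block determinant -/

/-- **Block determinant, scalar diagonal blocks**: for `G = [[g₁,g₂],[g₃,g₄]]`, `F = [[f₁,f₂],[f₃,f₄]]` and scalars `p q r s`,
`det [[p, 0, q g₁, q g₂],[0, p, q g₃, q g₄],[r f₁, r f₂, s, 0],[r f₃, r f₄, 0, s]] = (ps)² − ps·qr·tr(GF) + (qr)²·det G·det F`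
(`tr(GF) = g₁f₁ + g₂f₃ + g₃f₂ + g₄f₄`). [kernel, `ring`] -/
theorem det_block {R : Type*} [CommRing R] (p q r s g₁ g₂ g₃ g₄ f₁ f₂ f₃ f₄ : R) :
    Matrix.det !![p, 0, q * g₁, q * g₂; 0, p, q * g₃, q * g₄; r * f₁, r * f₂, s, 0; r * f₃, r * f₄, 0, s]
      = (p * s) ^ 2 - p * s * (q * r) * (g₁ * f₁ + g₂ * f₃ + g₃ * f₂ + g₄ * f₄)
        + (q * r) ^ 2 * ((g₁ * g₄ - g₂ * g₃) * (f₁ * f₄ - f₂ * f₃)) := by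
  rw [Matrix.det_succ_row_zero]
  simp [Fin.sum_univ_succ, Matrix.det_fin_three, Matrix.submatrix_apply, Fin.succAbove]
  ring

/-- **«covolume `|N_{F∕ℚ}(a₀)| = ((b²−m)∕4)²`»**: if `G·F = I` — of its four entries only `(GF)₁₁ = 1`, `(GF)₂₁ = 0`, `(GF)₂₂ = 1` are
needed — then `det [[p·I, q·G],[r·F, s·I]] = (ps − qr)²`. [kernel] -/
theorem det_block_of_inverse {R : Type*} [CommRing R] (p q r s g₁ g₂ g₃ g₄ f₁ f₂ f₃ f₄ : R)
    (h₁₁ : g₁ * f₁ + g₂ * f₃ = 1) (h₂₁ : g₃ * f₁ + g₄ * f₃ = 0) (h₂₂ : g₃ * f₂ + g₄ * f₄ = 1) :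
    Matrix.det !![p, 0, q * g₁, q * g₂; 0, p, q * g₃, q * g₄; r * f₁, r * f₂, s, 0; r * f₃, r * f₄, 0, s] = (p * s - q * r) ^ 2 := by
  rw [det_block]
  -- det G · det F = det (GF) = (GF)₁₁(GF)₂₂ − (GF)₁₂(GF)₂₁ and tr(GF) = (GF)₁₁ + (GF)₂₂, then substitute GF = I
  linear_combination (-(p * s * (q * r)) + (q * r) ^ 2 * (g₃ * f₂ + g₄ * f₄)) * h₁₁
    + (-(p * s * (q * r)) + (q * r) ^ 2) * h₂₂ - ((q * r) ^ 2 * (g₁ * f₂ + g₂ * f₄)) * h₂₁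

/-! ## §2 The value `ps − qr = (b² − m)∕4` -/

/-- **«`N_{F∕F^τ}(a₀) = (b² − m)∕4`»** as the `2 × 2` scalar determinant of the block matrix of `a₀ = (b + 𝒥)∕2`: with `p = (b−A)∕2`,
`q = −N∕2`, `r = t∕2`, `s = (b+A)∕2` and the target relation `tN = A² − m`: `ps − qr = (b² − m)∕4`. [kernel] -/
theorem ps_sub_qr {F : Type*} [Field F] [CharZero F] (b A N t m : F) (ht : t * N = A ^ 2 - m) :
    ((b - A) / 2) * ((b + A) / 2) - (-(N / 2)) * (t / 2) = (b ^ 2 - m) / 4 := by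
  linear_combination (1 / 4 : F) * ht

/-- **«`((b²−m)∕4)² = ¼ = covol(M′)`»**: if `b² − m = 2` or `b² − m = −2` then `(ps − qr)² = ((b² − m)∕4)² = 1∕4`. [kernel] -/
theorem covolume_cases {F : Type*} [Field F] [CharZero F] (b m : F) (h : b ^ 2 - m = 2 ∨ b ^ 2 - m = -2) :
    ((b ^ 2 - m) / 4) ^ 2 = 1 / 4 := by
  rcases h with h | h <;> rw [h] <;> norm_num

/-! ## §3 `ε₂ = sgn(b² − m)·ε₁` -/

/-- **«`ε₂ = ε₁ ∕ (2·N_{F∕F^τ}(a₀)) = ε₁ · 2∕(b² − m) = sgn(b² − m)·ε₁`»**: with `N(a₀) = (b² − m)∕4`, `ε₂ = ε₁∕(2N(a₀)) = 2ε₁∕(b² − m)`; so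
`b² − m = 2 ⇒ ε₂ = ε₁` and `b² − m = −2 ⇒ ε₂ = −ε₁`. [kernel] -/
theorem epsilon_ratio {F : Type*} [Field F] [CharZero F] (ε₁ ε₂ b m : F) (hε : ε₂ = ε₁ / (2 * ((b ^ 2 - m) / 4))) :
    (b ^ 2 - m = 2 → ε₂ = ε₁) ∧ (b ^ 2 - m = -2 → ε₂ = -ε₁) := by
  constructor
  · intro h; rw [hε, h]; ring
  · intro h; rw [hε, h]; ring

/-- **The instances** «`m = 3` (`b = 1`, `1 − 3 = −2`) …; `m = 11` (`b = 3`, `−2`) …; `m = 7` (`b = 3`, `+2`), `m = 23` (`b = 5`, `+2`), `m = −1`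
(`b = 1`, `+2`)»: `b` odd and `b² − m = ∓2` in each case. [kernel, `decide`] -/
theorem instances :
    ((1 : ℤ) ^ 2 - 3 = -2 ∧ (3 : ℤ) ^ 2 - 11 = -2) ∧ ((3 : ℤ) ^ 2 - 7 = 2 ∧ (5 : ℤ) ^ 2 - 23 = 2 ∧ (1 : ℤ) ^ 2 - (-1) = 2) ∧
      (Odd (1 : ℤ) ∧ Odd (3 : ℤ) ∧ Odd (5 : ℤ)) := by
  refine ⟨⟨by norm_num, by norm_num⟩, ⟨by norm_num, by norm_num, by norm_num⟩, ⟨by decide, by decide, by decide⟩⟩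

end Summit.Ventures.HSemireg.RatioLemma
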